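import Summits.BirchSwinnertonDyer.Rank1Residual.X11b.SelmerCongruenceOneSided
import Summits.BirchSwinnertonDyer.Rank1Residual.X11b.BDPRouteErratumData
import HarnessLib

/-!
# K2 crux 19270 `IMCDivAtErratumDataAll` (H3♭), ROAD FF — the KERNEL GLUE in two-ring,
# object-abstract form: the one-sided congruence transfer with the Selmer duals over `Λ_𝒪` and
# the `p`-adic `L`-functions over `Λ_𝒪^{ur}`, down to the crux's divisibility conjunct

Cell `bsd-stepL`, seat `bsd-stepL-imc-p1` (g7). `--supports stmt-BirchSwinnertonDyer-19270 --as helper`.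
HONEST FRAMING: BSD is not proved for any pair by this file; it closes no item; it types no new
object and introduces no named fact. It is the `≈ 150`-line "§3 glue" of the seat's spec
`SPEC-19270-RoadFF-objects-imc-p1-g6.md` (item evidence #12 on 19270), written BEFORE the objects
(D1 `bigRep T ⊗ Λ^*`, D2, D3) and the fact files (F1–F7) it consumes exist, with every one of them an
explicit hypothesis about ABSTRACT data — so that (a) the typers can state F1 ∕ F3 ∕ F4 ∕ F7 against
these hypotheses verbatim and (b) the by-name stubs `stub_imcDivErratum_nonsplitAtP` ∕ `_splitAtP`
become instantiations once D1 ∕ D2 ∕ F1–F7 land.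

## Why a new end form is needed (the two-ring point)

The erratum's passage "(b), Lemma 2.1, Fitting ideals, (c), [Ski16, p. 192] verbatim" (p. 4) is a
kernel theorem in the tree in two forms: the ONE-RING one-sided form
`CongruenceLimit.PowerSeriesDVR.charIdeal_le_span_of_congruences_printed` ∕
`TorsionControl.powerSeries_charIdeal_le_span_of_selmer_congruences` (the `L`'s in the SAME ring
`Λ_𝒪 = 𝒪⟦T⟧` as the Selmer duals), and the TWO-RING EQUALITY form
`CongruenceLimit.isTorsion_and_charIdeal_eq_of_congruences_baseChange` (needs `L ≠ 0` and the
two-sided input `Fitt_S(S ⊗ N_m) = (L_m)`). Road FF needs the TWO-RING ONE-SIDED form: the Selmer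
duals `X`, `X_m` and the congruence isomorphisms live over `R = Λ_𝒪`, while `L_𝔭(f)`, `L_𝔭(g_m)`,
the congruence (c) `(L_𝔭(g_m), p^m) = (L_𝔭(f), p^m)` [Cas20 Thm. 2.11] and FW21's one inclusion
`Ch(X_m)·Λ^{ur} ⊆ (L_m)` live over `S = Λ_𝒪^{ur} = 𝒪^{ur}⟦T⟧`; and the crux's frame `Q` lives in
`𝓞_{ℂ_p}⟦T⟧`, which is NOT Noetherian — Krull's intersection theorem must run in an intermediate
Noetherian `S` and the result be MAPPED to `𝓞_{ℂ_p}⟦T⟧`. This file proves exactly that, as pure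
algebra plus bookkeeping, for an ARBITRARY Noetherian `R`-algebra `S`.

## Contents

* §1 `CongruenceLimit.map_fittingIdeal_le_span_of_congruences` — the two-ring one-sided Fitting
  limit: `e m : M/I^m ≅ N_m/I^m` over `R`; `hF m : Fitt_R(N_m)·S ⊆ (L_m)`; `hc m : (L_m) + (IS)^m =
  (L) + (IS)^m` in `S` ⟹ `Fitt_R(M)·S ⊆ (L)` (`S` Noetherian, `IS ⊆ Jac S`). Input shape
  `map_fittingIdeal_zero_le_of_map_charIdeal_le`: "`Ch_R(N)·S ⊆ (L)` when `N` is torsion" ⟹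
  `Fitt_R(N)·S ⊆ (L)` (the shape in which [FW21, Thm. 4.41] ∕ erratum (2.5) print the input).
  `PowerSeriesDVR.map_charIdeal_le_span_of_congruences_printed`: over `R = 𝒪⟦T⟧` with `M` torsion
  and without nonzero finite-length submodule (erratum Lemma 2.2 for `f`), `Ch_R(M)·S ⊆ (L)`.
* §2 `TorsionControl.map_charIdeal_le_span_of_selmer_congruences` — the Selmer-level twin of
  `powerSeries_charIdeal_le_span_of_selmer_congruences` with the `L`'s in `S`: discrete `Λ_𝒪`-linear
  `Γ`-modules `M_f`, `M_{g_m}` with the socle form of Lemma 2.1's hypotheses, `θ m : M_{g_m}[a^m] ≅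
  M_f[a^m]`, `hCh m` (F4) and `hc m` (F3) in `S`, `hT` + `hnf` (F6) on `X_f = Sel(M_f)^∨` ⟹
  `Ch_{Λ_𝒪}(X_f)·S ⊆ (L_f)`.
* §3 `CongruenceLimit.map_le_span_of_transfer_of_imprimitive` — Σ-removal and receptacle
  bookkeeping along ring maps `Λ →i R →φ S →j T`: from `C^Σ = C^∅·(P_Σ)` in `Λ`, `C^Σ·R ⊆ 𝔠`
  (F1, Shapiro, inequality direction), `𝔠·S ⊆ (L^Σ)` (§1–§2), `(L^Σ) = (P_Σ·L)` in `S` (F7, [Cas18,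
  (3.1)]) and `(j L) = (Q)` in `T`: `C^∅·T ⊆ (Q)` (cancellation in the domain `S`).
* §4 `AcSelmer.XAc.map_charIdeal_le_span_of_roadFF` — §2 ∘ §3 in the crux's own currency: for
  ANY `W/K`, `κ`, `𝔭`, `Σ`, `γ`, the conjunct
  `(XAc.charIdeal W p κ 𝔭 ∅ γ).map (PowerSeries.map (R1.toCpInt p)) ≤ Ideal.span {Q}` of
  `P2.IMCDivIntCoreFrameAtErratumData` from the abstract Road-FF inputs, the receptacle condition
  being `j ∘ (Λ_𝒪 → S) ∘ i = PowerSeries.map (R1.toCpInt p)`.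

Dictionary (SPEC §2): `R = Λ_𝒪 = PowerSeries 𝒪` (`𝒪 ⊇ ℤ_p` finite, large enough for all `g_m` —
finitely many `p`-adic fields of bounded degree), `S = 𝒪^{ur}⟦T⟧`, `T = 𝓞_{ℂ_p}⟦T⟧`, `i = ℤ_p⟦T⟧ →
𝒪⟦T⟧`, `a = p`, `I = 𝔪`; `ρf = bigRep T_pE ⊗ 𝒪` (D1), `ρg m = bigRep T_{g_m}` (D2), `θ` = Hida (b)
mod `p^m` (F2, [Ski16, (2-6-1)]), socles = (F5), `hSh` = Shapiro + flat base change (F1, [SU14,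
Prop. 3.2.3]), `hCh` = (F4) = [FW21, Thm. 4.41] ∘ erratum (2.4)⇒(2.5) for the crystalline `g_m`,
`hc` = (F3) = [Cas20, Thm. 2.11] ∘ [Cas18, (4.1)], `hT`∕`hnf` = (F6), `hΣ`∕`hLΣ`∕`hP` = (F7) = [JSW17,
Prop. 3.3.2 + proof of Thm. 6.1.6] and [Cas18, (3.1)], `hQ` = the frame of [Cas18, Thm. 3.1] read in
`𝓞_{ℂ_p}⟦T⟧`. What this file does NOT do: construct any of these, prove FW21 4.41, touch (α)∕(β)∕¬(ram).

References: [Castella2018Erratum] Lemma 2.1, 2.2, Thm. 2.3, (2.4)–(2.5), proof of Thm. 1.1 (p. 4);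
[Skinner2016PacificMC] §2.6, §3.1 (p. 192); [FouquetWan2021] arXiv:2107.13726 Thm. 4.41 (PREPRINT);
[Castella2020] JIMJ 19, Thm. 2.11; [Castella2018] (3.1), Thm. 3.1, (4.1); [JetchevSkinnerWan2017]
Prop. 3.3.2, Cor. 3.4.2, Thm. 6.1.6; [SkinnerUrban2014] Prop. 3.2.3; [StacksProject] Tag 07ZA.
-/

noncomputable section

open scoped TensorProduct
open Literature.RingTheory.FittingIdeal Literature.NumberTheory.EllipticCurves
  Literature.NumberTheory.EllipticCurves.Module

/-! ### §1 The two-ring one-sided congruence limit (pure commutative algebra) -/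

namespace Summit.BirchSwinnertonDyer.Rank1Residual.X11b.CongruenceLimit

universe u v

section TwoRing

variable {R : Type u} [CommRing R] (S : Type v) [CommRing S] [Algebra R S]

/-- **The one-sided congruence limit in TWO rings** (erratum p. 4 read one-sidedly AND literally:
the Selmer duals `M = X`, `N_m = X_m` and the congruence isomorphisms `e m : M/I^m ≅ N_m/I^m`
((b) + Lemma 2.1) are over `R = Λ_𝒪`; the inputs `hF m : Fitt_R(N_m)·S ⊆ (L_m)` ((2.5) for `g_m`)
and `hc m : (L_m) + (IS)^m = (L) + (IS)^m` ((c)) are over an `R`-algebra `S = Λ_𝒪^{ur}` which is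
Noetherian with `IS ⊆ Jac(S)`). Conclusion: `Fitt_R(M)·S ⊆ (L)`. Proof: Fitting ideals commute with
base change (`Module.fittingIdeal_baseChange`, Stacks 07ZA), the `e m` base-change
(`nonempty_quotient_baseChange_equiv`), and the one-ring limit `fittingIdeal_le_span_of_congruences`
over `S` (Krull). No `L ≠ 0`, no torsionness, no "`Ch = Fitt`" anywhere.
[cite: Castella2018Erratum, proof of Thm. 1.1 (p. 4), read one-sidedly]
[cite: Skinner2016PacificMC, §3.1 (p. 192)] [cite: StacksProject, Tag 07ZA] -/
theorem map_fittingIdeal_le_span_of_congruences [IsNoetherianRing S]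
    {M : Type*} [AddCommGroup M] [Module R M] [Module.Finite R M]
    (N : ℕ → Type*) [∀ m, AddCommGroup (N m)] [∀ m, Module R (N m)] [∀ m, Module.Finite R (N m)]
    (I : Ideal R) (hI : I.map (algebraMap R S) ≤ (⊥ : Ideal S).jacobson) {L : S} (Lm : ℕ → S)
    (e : ∀ m : ℕ, 1 ≤ m →
      ((M ⧸ (I ^ m • (⊤ : Submodule R M))) ≃ₗ[R] (N m ⧸ (I ^ m • (⊤ : Submodule R (N m))))))
    (hF : ∀ m : ℕ, 1 ≤ m →
      (Module.fittingIdeal R (N m) 0).map (algebraMap R S) ≤ Ideal.span {Lm m})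
    (hc : ∀ m : ℕ, 1 ≤ m → Ideal.span {Lm m} ⊔ (I.map (algebraMap R S)) ^ m =
      Ideal.span {L} ⊔ (I.map (algebraMap R S)) ^ m) :
    (Module.fittingIdeal R M 0).map (algebraMap R S) ≤ Ideal.span {L} := by
  rw [← Module.fittingIdeal_baseChange]
  refine fittingIdeal_le_span_of_congruences (I.map (algebraMap R S)) (fun m => S ⊗[R] N m) Lm hI
    (fun m hm => Classical.choice (nonempty_quotient_baseChange_equiv S I m (e m hm))) ?_ hc
  intro m hm
  rw [Module.fittingIdeal_baseChange]
  exact hF m hm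

omit [Algebra R S] in
/-- **The printed shape of the input, mapped**: "`Ch_R(N)·S ⊆ (L)` (when `N` is `R`-torsion)"
implies `Fitt_R(N)·S ⊆ (L)`, for a finite module over a Noetherian UFD `R` and any ring map
`f : R → S` — if `N` is torsion, `Fitt₀ ⊆ Ch` (`fittingIdeal_zero_le_charIdeal`); if not,
`Fitt₀ ⊆ Ann = 0`. So the two-ring limit consumes [FW21, Thm. 4.41] ∕ erratum (2.5) for the `g_m`
exactly as printed ("`Ch_{Λ_𝒪}(X_m)Λ_𝒪^{ur} ⊆ (L^Σ_p(g_m))`", for torsion `X_m`), with no separate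
torsionness input. [cite: FouquetWan2021, Thm. 4.41 (shape of the conclusion)]
[cite: Castella2018Erratum, Thm. 2.3 and (2.5) (shape)] -/
theorem map_fittingIdeal_zero_le_of_map_charIdeal_le [IsNoetherianRing R] [IsDomain R]
    [UniqueFactorizationMonoid R] {N : Type*} [AddCommGroup N] [Module R N] [Module.Finite R N]
    (f : R →+* S) {L : S}
    (hCh : Module.IsTorsion R N → (charIdeal R N).map f ≤ Ideal.span {L}) :
    (Module.fittingIdeal R N 0).map f ≤ Ideal.span {L} := by
  by_cases hN : Module.IsTorsion R N
  · exact (Ideal.map_mono (fittingIdeal_zero_le_charIdeal hN)).trans (hCh hN)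
  · have h0 : Module.fittingIdeal R N 0 = ⊥ :=
      le_bot_iff.mp ((Module.fittingIdeal_zero_le_annihilator).trans
        (Module.annihilator_eq_bot_of_not_isTorsion hN).le)
    rw [h0, Ideal.map_bot]
    exact bot_le

end TwoRing

end Summit.BirchSwinnertonDyer.Rank1Residual.X11b.CongruenceLimit

/-! ### §1 (cont.) Over `R = Λ_𝒪 = 𝒪⟦T⟧`: the printed-input two-ring end form -/

namespace Summit.BirchSwinnertonDyer.Rank1Residual.X11b.CongruenceLimit.PowerSeriesDVR

open IsLocalRing

variable {𝒪 : Type} [CommRing 𝒪] [IsDomain 𝒪] [IsDiscreteValuationRing 𝒪]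
  [IsAdicComplete (maximalIdeal 𝒪) 𝒪]

/-- **`Ch_{Λ_𝒪}(X)·Λ_𝒪^{ur} ⊆ (L_p(f))` from the Greenberg side for the `g_m` alone — two-ring kernel
form, printed inputs.** `R = Λ_𝒪 = 𝒪⟦T⟧` (`𝒪` a complete DVR) carries the finite modules `M = X`,
`N_m = X_m` and `e m` [(b) + Lemma 2.1]; a Noetherian `R`-algebra `S` (`Λ_𝒪^{ur}`) with
`IS ⊆ Jac(S)` carries `L`, `L_m`, the ONE-SIDED input `hCh m : Ch_R(N_m)·S ⊆ (L_m)` when `N_m` is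
torsion [(2.5) for `g_m` ⇐ [FW21, Thm. 4.41]] and `hc m` [(c), [Cas20, Thm. 2.11]]; on `M`: `hT`
[torsion — control] and `hnf` [no nonzero finite-length submodule — erratum Lemma 2.2 for `f`].
THEN `Fitt_R(M) = Ch_R(M)` and `Ch_R(M)·S ⊆ (L)`. Not used: `L ≠ 0`, Lemma 2.2 ∕ torsionness for the
`g_m`, the Euler-system divisibility (2.3). Pure algebra; CONDITIONAL on nothing.
[cite: Castella2018Erratum, proof of Thm. 1.1 (p. 4), read one-sidedly]
[cite: Skinner2016PacificMC, §3.1 (p. 192)] -/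
theorem map_charIdeal_le_span_of_congruences_printed
    {M : Type} [AddCommGroup M] [Module (PowerSeries 𝒪) M] [Module.Finite (PowerSeries 𝒪) M]
    (N : ℕ → Type) [∀ m, AddCommGroup (N m)] [∀ m, Module (PowerSeries 𝒪) (N m)]
    [∀ m, Module.Finite (PowerSeries 𝒪) (N m)]
    (S : Type) [CommRing S] [Algebra (PowerSeries 𝒪) S] [IsNoetherianRing S]
    (I : Ideal (PowerSeries 𝒪))
    (hI : I.map (algebraMap (PowerSeries 𝒪) S) ≤ (⊥ : Ideal S).jacobson)
    {L : S} (Lm : ℕ → S)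
    (e : ∀ m : ℕ, 1 ≤ m →
      ((M ⧸ (I ^ m • (⊤ : Submodule (PowerSeries 𝒪) M))) ≃ₗ[PowerSeries 𝒪]
        (N m ⧸ (I ^ m • (⊤ : Submodule (PowerSeries 𝒪) (N m))))))
    (hCh : ∀ m : ℕ, 1 ≤ m → Module.IsTorsion (PowerSeries 𝒪) (N m) →
      (charIdeal (PowerSeries 𝒪) (N m)).map (algebraMap (PowerSeries 𝒪) S) ≤ Ideal.span {Lm m})
    (hc : ∀ m : ℕ, 1 ≤ m → Ideal.span {Lm m} ⊔ (I.map (algebraMap (PowerSeries 𝒪) S)) ^ m =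
      Ideal.span {L} ⊔ (I.map (algebraMap (PowerSeries 𝒪) S)) ^ m)
    (hT : Module.IsTorsion (PowerSeries 𝒪) M)
    (hnf : ∀ N' : Submodule (PowerSeries 𝒪) M, Module.length (PowerSeries 𝒪) N' ≠ ⊤ → N' = ⊥) :
    Module.fittingIdeal (PowerSeries 𝒪) M 0 = charIdeal (PowerSeries 𝒪) M ∧
      (charIdeal (PowerSeries 𝒪) M).map (algebraMap (PowerSeries 𝒪) S) ≤ Ideal.span {L} := by
  have hFitt : (Module.fittingIdeal (PowerSeries 𝒪) M 0).map (algebraMap (PowerSeries 𝒪) S) ≤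
      Ideal.span {L} :=
    map_fittingIdeal_le_span_of_congruences S N I hI Lm e
      (fun m hm => map_fittingIdeal_zero_le_of_map_charIdeal_le S (algebraMap (PowerSeries 𝒪) S)
        (hCh m hm)) hc
  have hFC : Module.fittingIdeal (PowerSeries 𝒪) M 0 = charIdeal (PowerSeries 𝒪) M :=
    fittingIdeal_zero_eq_charIdeal_of_forall_length M hT hnf
  exact ⟨hFC, hFC ▸ hFitt⟩

end Summit.BirchSwinnertonDyer.Rank1Residual.X11b.CongruenceLimit.PowerSeriesDVR

/-! ### §2 The Selmer-level two-ring end form -/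

namespace Summit.BirchSwinnertonDyer.Rank1Residual.X11b.TorsionControl

open CategoryTheory Literature.NumberTheory.GaloisRepresentations IsLocalRing
open scoped ContRepresentation

variable {𝒪 : Type} [CommRing 𝒪] [IsDomain 𝒪] [IsDiscreteValuationRing 𝒪]
  [IsAdicComplete (maximalIdeal 𝒪) 𝒪] [TopologicalSpace (PowerSeries 𝒪)]
variable {Γ₀ : Type} [Group Γ₀] [TopologicalSpace Γ₀] [IsTopologicalGroup Γ₀]
variable {ι₀ : Type*} {Γw : ι₀ → Type} [∀ v, Group (Γw v)] [∀ v, TopologicalSpace (Γw v)]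
  [∀ v, IsTopologicalGroup (Γw v)] (ψ : ∀ v, Γw v →ₜ* Γ₀) (L₀ : Set ι₀)

/-- **`Ch_{Λ_𝒪}(Sel(M_f)^∨)·S ⊆ (L_f)` over `Λ_𝒪 = 𝒪⟦T⟧` with the `p`-adic `L`-functions in an
`Λ_𝒪`-algebra `S` (`= Λ_𝒪^{ur}`)** — the two-ring twin of
`powerSeries_charIdeal_le_span_of_selmer_congruences`. Inputs: the discrete `Λ_𝒪`-linear
`Γ`-modules `M_f` (`ρf`; D1: `T_pE ⊗ 𝒪 ⊗ Λ_𝒪^*`) and `M_{g_m}` (`ρg m`; D2), `a`-divisible and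
`I`-primary, with Lemma 2.1's hypotheses in SOCLE form (no nonzero `Γ`- or `Γ_v`-invariant in the
socles `M[I] ≅ ρ̄`, `v ∈ L₀`: F5 = irreducibility of `ρ̄|_{G_K}` [Ski20 Lem. 2.8.1] and (iv));
`θ m : M_{g_m}[a^m] ≅ M_f[a^m]` (F2 = Hida (b) mod `p^m`, [Ski16, (2-6-1)]); in `S` (Noetherian,
`(a)S ⊆ Jac S`): `hCh m` = F4 = "`Ch_{Λ_𝒪}(Sel(M_{g_m})^∨)·S ⊆ (L_m)` when torsion" ([FW21, Thm. 4.41]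
∘ erratum (2.4)⇒(2.5) for the crystalline `g_m`) and `hc m` = F3 = "`(L_m) + (a)^m = (L_f) + (a)^m`"
([Cas20, Thm. 2.11]); on `X_f = Sel(M_f)^∨`: `hT` (torsion) and `hnf` (erratum Lemma 2.2 for `f`).
Output: `Fitt(X_f) = Ch(X_f)` and `Ch_{Λ_𝒪}(X_f)·S ⊆ (L_f)`. Universe `Type`.
[cite: Castella2018Erratum, Lemma 2.1 and proof of Thm. 1.1 (p. 4), read one-sidedly]
[cite: Skinner2016PacificMC, §2.6 (2-6-1) and §3.1 (p. 192)] -/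
theorem map_charIdeal_le_span_of_selmer_congruences
    (a : PowerSeries 𝒪) (I : Ideal (PowerSeries 𝒪))
    {Mf : Type} [AddCommGroup Mf] [Module (PowerSeries 𝒪) Mf] [TopologicalSpace Mf]
    [DiscreteTopology Mf] [ContinuousSMul (PowerSeries 𝒪) Mf] (ρf : ContinuousRep Γ₀ (PowerSeries 𝒪) Mf)
    (hdivf : Function.Surjective fun x : Mf => a • x)
    (hprimf : ∀ x : Mf, ∃ n : ℕ, ∀ b ∈ I ^ n, b • x = 0)
    (hsocf : ∀ x : Mf, (∀ b ∈ I, b • x = 0) → (∀ g : Γ₀, ρf g x = x) → x = 0)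
    (hsoclf : ∀ v ∈ L₀, ∀ x : Mf, (∀ b ∈ I, b • x = 0) → (∀ h : Γw v, ρf (ψ v h) x = x) → x = 0)
    (Mg : ℕ → Type) [∀ m, AddCommGroup (Mg m)] [∀ m, Module (PowerSeries 𝒪) (Mg m)]
    [∀ m, TopologicalSpace (Mg m)] [∀ m, DiscreteTopology (Mg m)]
    [∀ m, ContinuousSMul (PowerSeries 𝒪) (Mg m)] (ρg : ∀ m, ContinuousRep Γ₀ (PowerSeries 𝒪) (Mg m))
    (hdivg : ∀ m, 1 ≤ m → Function.Surjective fun x : Mg m => a • x)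
    (hprimg : ∀ m, 1 ≤ m → ∀ x : Mg m, ∃ n : ℕ, ∀ b ∈ I ^ n, b • x = 0)
    (hsocg : ∀ m, 1 ≤ m → ∀ x : Mg m, (∀ b ∈ I, b • x = 0) → (∀ g : Γ₀, ρg m g x = x) → x = 0)
    (hsoclg : ∀ m, 1 ≤ m → ∀ v ∈ L₀, ∀ x : Mg m, (∀ b ∈ I, b • x = 0) →
      (∀ h : Γw v, ρg m (ψ v h) x = x) → x = 0)
    (θ : ∀ m, 1 ≤ m → ((torsionRep (ρg m) (a ^ m)).toTopRep ≅ (torsionRep ρf (a ^ m)).toTopRep))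
    [Module.Finite (PowerSeries 𝒪) (CharacterModule (selmer ψ L₀ ρf))]
    [∀ m, Module.Finite (PowerSeries 𝒪) (CharacterModule (selmer ψ L₀ (ρg m)))]
    (S : Type) [CommRing S] [Algebra (PowerSeries 𝒪) S] [IsNoetherianRing S]
    (ha : (Ideal.span {a}).map (algebraMap (PowerSeries 𝒪) S) ≤ (⊥ : Ideal S).jacobson)
    {Lf : S} (Lg : ℕ → S)
    (hCh : ∀ m, 1 ≤ m → Module.IsTorsion (PowerSeries 𝒪) (CharacterModule (selmer ψ L₀ (ρg m))) →
      (charIdeal (PowerSeries 𝒪) (CharacterModule (selmer ψ L₀ (ρg m)))).map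
        (algebraMap (PowerSeries 𝒪) S) ≤ Ideal.span {Lg m})
    (hc : ∀ m, 1 ≤ m →
      Ideal.span {Lg m} ⊔ ((Ideal.span {a}).map (algebraMap (PowerSeries 𝒪) S)) ^ m =
        Ideal.span {Lf} ⊔ ((Ideal.span {a}).map (algebraMap (PowerSeries 𝒪) S)) ^ m)
    (hT : Module.IsTorsion (PowerSeries 𝒪) (CharacterModule (selmer ψ L₀ ρf)))
    (hnf : ∀ N' : Submodule (PowerSeries 𝒪) (CharacterModule (selmer ψ L₀ ρf)),
      Module.length (PowerSeries 𝒪) N' ≠ ⊤ → N' = ⊥) :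
    Module.fittingIdeal (PowerSeries 𝒪) (CharacterModule (selmer ψ L₀ ρf)) 0 =
        charIdeal (PowerSeries 𝒪) (CharacterModule (selmer ψ L₀ ρf)) ∧
      (charIdeal (PowerSeries 𝒪) (CharacterModule (selmer ψ L₀ ρf))).map
          (algebraMap (PowerSeries 𝒪) S) ≤ Ideal.span {Lf} :=
  CongruenceLimit.PowerSeriesDVR.map_charIdeal_le_span_of_congruences_printed
    (fun m => CharacterModule (selmer ψ L₀ (ρg m))) S (Ideal.span {a}) ha Lg
    (fun m hm => Classical.choice
      (PontryaginCongruence.nonempty_quotIdealPow_equiv_of_torsionBy_equiv a m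
        (Classical.choice (nonempty_torsionBy_selmer_equiv_of_socle ψ L₀ a I m ρf (ρg m) hdivf
          hprimf hsocf hsoclf (hdivg m hm) (hprimg m hm) (hsocg m hm) (hsoclg m hm) (θ m hm)))))
    hCh hc hT hnf

end Summit.BirchSwinnertonDyer.Rank1Residual.X11b.TorsionControl

/-! ### §3 Σ-removal and receptacle bookkeeping `Λ → Λ_𝒪 → Λ_𝒪^{ur} → 𝓞_{ℂ_p}⟦T⟧` -/

namespace Summit.BirchSwinnertonDyer.Rank1Residual.X11b.CongruenceLimit

/-- **From the `Σ`-imprimitive transfer to the primitive divisibility in the final receptacle.**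
Ring maps `Λ →i R →φ S →j T` (`ℤ_p⟦T⟧ → 𝒪⟦T⟧ → 𝒪^{ur}⟦T⟧ → 𝓞_{ℂ_p}⟦T⟧`), `S` a domain. Inputs:
`hΣ : C^Σ = C^∅ · (P_Σ)` in `Λ` (F7, Selmer side: [JSW17, Prop. 3.3.2 + proof of Thm. 6.1.6] —
`char(X^Σ_ac) = char(X^∅_ac) · ∏_{w ∈ Σ} P_w`), `hSh : C^Σ·R ⊆ 𝔠` (F1, Shapiro + base change,
the inequality direction: `𝔠 = Ch_{Λ_𝒪}(Sel(M_f)^∨)`), `h𝔠 : 𝔠·S ⊆ (L^Σ)` (§1–§2),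
`hLΣ : (L^Σ) = (P_Σ · L)` in `S` (F7, `L`-side: [Cas18, (3.1)] `L^Σ_p(f) := L_p(f) · ∏_{w∈Σ} P_w`),
`hP : P_Σ ≠ 0` in `S`, `hQ : (j L) = (Q)` in `T` (the frame, up to a unit). Output:
`C^∅·T ⊆ (Q)`. Proof: multiplicativity of `Ideal.map`, cancellation of the nonzero principal
factor `(P_Σ)` in the domain `S`, then `Ideal.map j`. [cite: JetchevSkinnerWan2017, Thm. 6.1.6 (proof: Σ-change identity)]
[cite: Castella2018, (3.1) (definition of the Σ-imprimitive L-function)] -/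
theorem map_le_span_of_transfer_of_imprimitive
    {Λ R S T : Type*} [CommRing Λ] [CommRing R] [CommRing S] [IsDomain S] [CommRing T]
    (i : Λ →+* R) (φ : R →+* S) (j : S →+* T)
    {CS C0 : Ideal Λ} {PS : Λ} (hSig : CS = C0 * Ideal.span {PS}) (hP : φ (i PS) ≠ 0)
    {𝔠 : Ideal R} (hSh : CS.map i ≤ 𝔠)
    {LS L : S} (h𝔠 : 𝔠.map φ ≤ Ideal.span {LS})
    (hLS : Ideal.span {LS} = Ideal.span {φ (i PS) * L})
    {Q : T} (hQ : Ideal.span {j L} = Ideal.span {Q}) :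
    C0.map (j.comp (φ.comp i)) ≤ Ideal.span {Q} := by
  -- `C^Σ·S ⊆ (L^Σ) = (P_Σ · L)`
  have h1 : (CS.map i).map φ ≤ Ideal.span {φ (i PS) * L} :=
    hLS ▸ (Ideal.map_mono hSh).trans h𝔠
  -- `C^Σ·S = C^∅·S · (P_Σ)`
  have h2 : (CS.map i).map φ = (C0.map (φ.comp i)) * Ideal.span {φ (i PS)} := by
    rw [Ideal.map_map, hSig, Ideal.map_mul, Ideal.map_span, Set.image_singleton, RingHom.comp_apply]
  -- cancel `(P_Σ)` in the domain `S`
  have h3 : C0.map (φ.comp i) ≤ Ideal.span {L} := by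
    rw [h2, mul_comm (φ (i PS)) L, ← Ideal.span_singleton_mul_span_singleton] at h1
    exact (Ideal.span_singleton_mul_left_mono hP).mp h1
  -- map to the receptacle `T`
  have h4 : (C0.map (φ.comp i)).map j ≤ Ideal.span {j L} := by
    refine (Ideal.map_mono h3).trans (le_of_eq ?_)
    rw [Ideal.map_span, Set.image_singleton]
  rw [← Ideal.map_map]
  exact h4.trans (le_of_eq hQ)

end Summit.BirchSwinnertonDyer.Rank1Residual.X11b.CongruenceLimit

/-! ### §4 The crux's divisibility conjunct from the Road-FF inputs -/

namespace Summit.BirchSwinnertonDyer.Rank1Residual.X11b.AcSelmer.XAc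

open CategoryTheory Literature.NumberTheory.GaloisRepresentations IsLocalRing NumberField
  IsDedekindDomain Field TorsionControl
open scoped ContRepresentation

/-- **ROAD FF, KERNEL GLUE — the divisibility conjunct of `P2.IMCDivIntCoreFrameAtErratumData` ∕
`IMCDivAtErratumDataAll` (crux 19270) from the SPEC inputs, for ANY `W/K`, `κ`, `𝔭`, `Σ`, `γ`.**
Receptacle: ring maps `Λ = ℤ_p⟦T⟧ →i Λ_𝒪 = 𝒪⟦T⟧ → S → 𝓞_{ℂ_p}⟦T⟧` composing to the crux's
`PowerSeries.map (R1.toCpInt p)` (`hcomp`), `S` a Noetherian domain (`𝒪^{ur}⟦T⟧`) with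
`(a)S ⊆ Jac S` (`a = p`). Galois side over `Λ_𝒪` (D1 `ρf = bigRep (T_pE ⊗ 𝒪)`, D2 `ρg m`, their
`a`-divisibility ∕ `I`-primarity ∕ socle hypotheses = F5, `θ` = F2, finite generation of the dual
Selmer groups), `hSh` = F1 (Shapiro + base change `ℤ_p → 𝒪`, inequality direction:
`Ch_Λ(X^Σ_ac(E[p^∞]))·Λ_𝒪 ⊆ Ch_{Λ_𝒪}(Sel^Σ(M_f)^∨)`), `hSig`∕`hP`∕`hLS` = F7 (Σ-removal on both
sides with the SAME Euler factor `P_Σ ∈ Λ`), `hCh` = F4 ([FW21, Thm. 4.41] for the `g_m`, ONE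
inclusion, in `S`), `hc` = F3 ([Cas20, Thm. 2.11], in `S`), `hT`∕`hnf` = F6 on `X_f`, `hQ`: the
crux's frame `Q` generates `(j L_f)` in `𝓞_{ℂ_p}⟦T⟧`. Conclusion — LITERALLY the last conjunct of
the crux at the datum: `Ch_Λ(X^∅_ac)·𝓞_{ℂ_p}⟦T⟧ ⊆ (Q)`. With D1∕D2∕F1–F7 landed, the by-name stubs
`stub_imcDivErratum_nonsplitAtP` ∕ `_splitAtP` are `⟨Ω_K, Ω_p, Q, …, this⟩` at each erratum datum.
CONDITIONAL on its hypotheses only; closes nothing; BSD proved for no pair.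
[cite: Castella2018Erratum, Thm. 1.1 ⇐ Thm. 2.3, proof p. 4, read one-sidedly]
[cite: Skinner2016PacificMC, §3.1 (p. 192)] [cite: Castella2018, (3.1) and Thm. 3.1]
[cite: JetchevSkinnerWan2017, Prop. 3.3.2 and Thm. 6.1.6 (proof)] -/
theorem map_charIdeal_le_span_of_roadFF
    {K : Type} [Field K] [NumberField K] (W : WeierstrassCurve K) (p : ℕ) [Fact p.Prime]
    (κ : ZpExtension K p) (𝔭 : HeightOneSpectrum (𝓞 K)) (Sg : Set (HeightOneSpectrum (𝓞 K)))
    (γ : absoluteGaloisGroup K) [Fact (κ.IsTopGenerator γ)]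
    -- receptacle
    {𝒪 : Type} [CommRing 𝒪] [IsDomain 𝒪] [IsDiscreteValuationRing 𝒪]
    [IsAdicComplete (maximalIdeal 𝒪) 𝒪] [TopologicalSpace (PowerSeries 𝒪)]
    (S : Type) [CommRing S] [IsDomain S] [IsNoetherianRing S] [Algebra (PowerSeries 𝒪) S]
    (i : IwasawaAlgebra p →+* PowerSeries 𝒪) (j : S →+* PowerSeries 𝓞_ℂ_[p])
    (hcomp : j.comp ((algebraMap (PowerSeries 𝒪) S).comp i) = PowerSeries.map (R1.toCpInt p))
    (a : PowerSeries 𝒪) (ha : (Ideal.span {a}).map (algebraMap (PowerSeries 𝒪) S) ≤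
      (⊥ : Ideal S).jacobson) (I : Ideal (PowerSeries 𝒪))
    -- Galois side over `Λ_𝒪`
    {Γ₀ : Type} [Group Γ₀] [TopologicalSpace Γ₀] [IsTopologicalGroup Γ₀]
    {ι₀ : Type*} {Γw : ι₀ → Type} [∀ v, Group (Γw v)] [∀ v, TopologicalSpace (Γw v)]
    [∀ v, IsTopologicalGroup (Γw v)] (ψ : ∀ v, Γw v →ₜ* Γ₀) (L₀ : Set ι₀)
    {Mf : Type} [AddCommGroup Mf] [Module (PowerSeries 𝒪) Mf] [TopologicalSpace Mf]
    [DiscreteTopology Mf] [ContinuousSMul (PowerSeries 𝒪) Mf] (ρf : ContinuousRep Γ₀ (PowerSeries 𝒪) Mf)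
    (hdivf : Function.Surjective fun x : Mf => a • x)
    (hprimf : ∀ x : Mf, ∃ n : ℕ, ∀ b ∈ I ^ n, b • x = 0)
    (hsocf : ∀ x : Mf, (∀ b ∈ I, b • x = 0) → (∀ g : Γ₀, ρf g x = x) → x = 0)
    (hsoclf : ∀ v ∈ L₀, ∀ x : Mf, (∀ b ∈ I, b • x = 0) → (∀ h : Γw v, ρf (ψ v h) x = x) → x = 0)
    (Mg : ℕ → Type) [∀ m, AddCommGroup (Mg m)] [∀ m, Module (PowerSeries 𝒪) (Mg m)]
    [∀ m, TopologicalSpace (Mg m)] [∀ m, DiscreteTopology (Mg m)]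
    [∀ m, ContinuousSMul (PowerSeries 𝒪) (Mg m)] (ρg : ∀ m, ContinuousRep Γ₀ (PowerSeries 𝒪) (Mg m))
    (hdivg : ∀ m, 1 ≤ m → Function.Surjective fun x : Mg m => a • x)
    (hprimg : ∀ m, 1 ≤ m → ∀ x : Mg m, ∃ n : ℕ, ∀ b ∈ I ^ n, b • x = 0)
    (hsocg : ∀ m, 1 ≤ m → ∀ x : Mg m, (∀ b ∈ I, b • x = 0) → (∀ g : Γ₀, ρg m g x = x) → x = 0)
    (hsoclg : ∀ m, 1 ≤ m → ∀ v ∈ L₀, ∀ x : Mg m, (∀ b ∈ I, b • x = 0) →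
      (∀ h : Γw v, ρg m (ψ v h) x = x) → x = 0)
    (θ : ∀ m, 1 ≤ m → ((torsionRep (ρg m) (a ^ m)).toTopRep ≅ (torsionRep ρf (a ^ m)).toTopRep))
    [Module.Finite (PowerSeries 𝒪) (CharacterModule (selmer ψ L₀ ρf))]
    [∀ m, Module.Finite (PowerSeries 𝒪) (CharacterModule (selmer ψ L₀ (ρg m)))]
    -- F1 (Shapiro, inequality direction) and F7 (Σ-removal)
    (hSh : (XAc.charIdeal W p κ 𝔭 Sg γ).map i ≤
      Literature.NumberTheory.EllipticCurves.Module.charIdeal (PowerSeries 𝒪)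
        (CharacterModule (selmer ψ L₀ ρf)))
    {PS : IwasawaAlgebra p}
    (hSig : XAc.charIdeal W p κ 𝔭 Sg γ = XAc.charIdeal W p κ 𝔭 ∅ γ * Ideal.span {PS})
    (hP : algebraMap (PowerSeries 𝒪) S (i PS) ≠ 0)
    {LS Lf : S} (hLS : Ideal.span {LS} = Ideal.span {algebraMap (PowerSeries 𝒪) S (i PS) * Lf})
    -- F4 and F3 in `S`, F6 on `X_f`
    (Lg : ℕ → S)
    (hCh : ∀ m, 1 ≤ m → Module.IsTorsion (PowerSeries 𝒪) (CharacterModule (selmer ψ L₀ (ρg m))) →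
      (Literature.NumberTheory.EllipticCurves.Module.charIdeal (PowerSeries 𝒪)
        (CharacterModule (selmer ψ L₀ (ρg m)))).map
        (algebraMap (PowerSeries 𝒪) S) ≤ Ideal.span {Lg m})
    (hc : ∀ m, 1 ≤ m →
      Ideal.span {Lg m} ⊔ ((Ideal.span {a}).map (algebraMap (PowerSeries 𝒪) S)) ^ m =
        Ideal.span {LS} ⊔ ((Ideal.span {a}).map (algebraMap (PowerSeries 𝒪) S)) ^ m)
    (hT : Module.IsTorsion (PowerSeries 𝒪) (CharacterModule (selmer ψ L₀ ρf)))
    (hnf : ∀ N' : Submodule (PowerSeries 𝒪) (CharacterModule (selmer ψ L₀ ρf)),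
      Module.length (PowerSeries 𝒪) N' ≠ ⊤ → N' = ⊥)
    -- the frame in the final receptacle
    {Q : PowerSeries 𝓞_ℂ_[p]} (hQ : Ideal.span {j Lf} = Ideal.span {Q}) :
    (XAc.charIdeal W p κ 𝔭 ∅ γ).map (PowerSeries.map (R1.toCpInt p)) ≤ Ideal.span {Q} := by
  have h𝔠 := (map_charIdeal_le_span_of_selmer_congruences ψ L₀ a I ρf hdivf hprimf hsocf hsoclf Mg
    ρg hdivg hprimg hsocg hsoclg θ S ha Lg hCh hc hT hnf).2
  rw [← hcomp]
  exact CongruenceLimit.map_le_span_of_transfer_of_imprimitive i (algebraMap (PowerSeries 𝒪) S) j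
    hSig hP hSh h𝔠 hLS hQ

end Summit.BirchSwinnertonDyer.Rank1Residual.X11b.AcSelmer.XAc

end
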